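import Literature.Analysis.FluidPDE.HeatNewtonIdentity
import Literature.Analysis.FluidPDE.CaloricBackwardKernels
import Literature.Analysis.FluidPDE.ParabolicRieszPotential
import HarnessLib

/-!
# Pointwise kernel bounds for the representation (13.50)–(13.52) of Lemarié-Rieusset 2016

Analysis/FluidPDE support file (everything proved) for the discharge of the named fact
`Literature.Analysis.FluidPDE.LemarieRieusset2016.step3_velocityBound`
(`CKNMorreyRepresentation.lean`; Lemarié-Rieusset 2016, §13.9 Step 3, (13.50)–(13.52),
pp. 474–475: the localised velocity `v = φu` is dominated by parabolic Riesz potentials of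
`1_{Q₂}|u|`, `1_{Q₂}|f|`, `1_{Q₂}|u|²`, …). The printed argument rests on three kernel bounds
against the parabolic distance `δ₂((t,x),(s,y)) = |t-s|^{1/2} + |x-y|`:

* the heat kernel `|W_{νt}(x)| ≤ C δ₂^{-3}` and its gradient `|∇W_{νt}(x)| ≤ C δ₂^{-4}`;
* "the kernel of `e^{νtΔ}∇∂ⱼ∂ₗΔ⁻¹` is `O(δ₂^{-4})`" (the Oseen tensor, Lemarié-Rieusset 2016,
  §6.2; Koch–Tataru 2001, (8), (14)).

This file records them in the form consumed downstream, in dimension three: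

* `exists_abs_iteratedFDeriv_three_heatKernel_le` — `|D³G_s(y)[u,v,w]| ≤ C (s + ‖y‖²)^{-(d+3)/2}`
  for `‖u‖, ‖v‖, ‖w‖ ≤ 1` (every dimension), and its time integral
  `∫_a^∞ |D³G_s(y)[u,v,w]| ds ≤ C (a + ‖y‖²)^{-2}` in `ℝ³`;
* `exists_abs_heatD3_newtonNear_le` — **the pointwise Oseen bound for the truncated Newtonian
  kernel**: `|∂ᵤ∂ᵥ∂_w e^{aΔ}Γ₀ (x)| ≤ C ((a + ‖x‖²)^{-2} + 1)` for `a > 0`, `‖u‖,‖v‖,‖w‖ ≤ 1`,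
  `Γ₀ = newtonNear r₀ r₁` (from the Duhamel representation
  `heatD3 a Γ₀ = -∫_a^∞ (D³G_s - heatD3 s λ) ds` of `HeatNewtonIdentity.lean`; the smoothing
  remainder `λ = Δ((1-θ)Γ)` contributes a bounded amount);
* the heat kernel and its gradient against `(a + ‖y‖²)` in `ℝ³`
  (`exists_heatKernel_le_add_sq_rpow_dim3`, `exists_abs_heatKernelGrad_le_dim3`), and the
  comparison of `(ν(t-s) + ‖x-y‖²)^{-e}` with `δ₂((t,x),(s,y))^{-2e}`
  (`add_sq_rpow_neg_le_parabolicDist_rpow`, and an `ℝ≥0∞` form against the Riesz kernels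
  `(ofReal δ₂ ^ (5-α))⁻¹` of `parabolicRieszPotential`).

## References

* P. G. Lemarié-Rieusset, *The Navier–Stokes Problem in the 21st Century*, CRC Press (2016),
  §13.9 Step 3, (13.50)–(13.52), pp. 474–475; §6.2 (Oseen tensor). [LemarieRieusset2016]
* H. Koch, D. Tataru, Adv. Math. 157 (2001), §2 (8), §3 (14). [KochTataruAdvMath2001]
-/

noncomputable section

open MeasureTheory Set Function Filter Topology Metric Real
open scoped ENNReal NNReal RealInnerProductSpace

namespace Literature.Analysis.FluidPDE

open UnboundedOperators (heatKernel)

/-! ### The third derivatives of the heat kernel against the parabolic distance -/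

section General

variable {E : Type*} [NormedAddCommGroup E] [InnerProductSpace ℝ E] [FiniteDimensional ℝ E]
  [MeasurableSpace E] [BorelSpace E]

omit [FiniteDimensional ℝ E] [MeasurableSpace E] [BorelSpace E] in
/-- `|⟪y, a⟫| ≤ ‖y‖` for `‖a‖ ≤ 1`. [folklore] -/
theorem abs_inner_le_norm_of_norm_le_one {a : E} (ha : ‖a‖ ≤ 1) (y : E) : |⟪y, a⟫| ≤ ‖y‖ := by
  calc |⟪y, a⟫| ≤ ‖y‖ * ‖a‖ := abs_real_inner_le_norm y a
    _ ≤ ‖y‖ * 1 := by gcongr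
    _ = ‖y‖ := mul_one _

omit [FiniteDimensional ℝ E] [MeasurableSpace E] [BorelSpace E] in
/-- `|⟪a, b⟫| ≤ 1` for `‖a‖, ‖b‖ ≤ 1`. [folklore] -/
theorem abs_inner_le_one_of_norm_le_one {a b : E} (ha : ‖a‖ ≤ 1) (hb : ‖b‖ ≤ 1) :
    |⟪a, b⟫| ≤ 1 := by
  calc |⟪a, b⟫| ≤ ‖a‖ * ‖b‖ := abs_real_inner_le_norm a b
    _ ≤ 1 * 1 := by gcongr
    _ = 1 := mul_one _

omit [FiniteDimensional ℝ E] [MeasurableSpace E] [BorelSpace E] in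
/-- **The third derivatives of the heat kernel against the parabolic distance**: there is
`C = C(E)` with `|D³G_s(y)[u, v, w]| ≤ C (s + ‖y‖²)^{-(d+3)/2}` for all `s > 0`, `y`, and
`‖u‖, ‖v‖, ‖w‖ ≤ 1` (the closed form `D³G_s(y) = G_s(y)(Q₁/(4s²) - Q₂/(8s³))`,
`|Q₁| ≤ 3‖y‖`, `|Q₂| ≤ ‖y‖³`, and the Gaussian decay `G_s ≤ C s^{e-d/2}(s + ‖y‖²)^{-e}`;
Koch–Tataru 2001, §2 (8)). [cite: KochTataruAdvMath2001, §2 (8)] -/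
theorem exists_abs_iteratedFDeriv_three_heatKernel_le :
    ∃ C : ℝ, 0 < C ∧ ∀ {s : ℝ}, 0 < s → ∀ (y u v w : E), ‖u‖ ≤ 1 → ‖v‖ ≤ 1 → ‖w‖ ≤ 1 →
      |iteratedFDeriv ℝ 3 (heatKernel s) y ![u, v, w]| ≤
        C * (s + ‖y‖ ^ 2) ^ (-(((Module.finrank ℝ E : ℝ) + 3) / 2)) := by
  set d : ℝ := (Module.finrank ℝ E : ℝ) with hd
  obtain ⟨C₁, hC₁, h₁⟩ := exists_heatKernel_le_rpow (E := E) (d / 2 + 2)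
  obtain ⟨C₂, hC₂, h₂⟩ := exists_heatKernel_le_rpow (E := E) (d / 2 + 3)
  refine ⟨3 / 4 * C₁ + C₂ / 8, by positivity, fun {s} hs y u v w hu hv hw => ?_⟩
  set ρ : ℝ := s + ‖y‖ ^ 2 with hρ
  have hρ0 : 0 < ρ := by positivity
  have hyρ : ‖y‖ ≤ ρ ^ (1 / 2 : ℝ) := norm_le_add_sq_rpow_half hs.le y
  have hG0 : 0 ≤ heatKernel s y := (UnboundedOperators.heatKernel_pos hs y).le
  -- the two Gaussian bounds
  have hG₁ : heatKernel s y ≤ C₁ * s ^ (2 : ℝ) * ρ ^ (-(d / 2 + 2)) := by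
    have := h₁ hs y
    rwa [show d / 2 + 2 - (Module.finrank ℝ E : ℝ) / 2 = 2 by rw [hd]; ring] at this
  have hG₂ : heatKernel s y ≤ C₂ * s ^ (3 : ℝ) * ρ ^ (-(d / 2 + 3)) := by
    have := h₂ hs y
    rwa [show d / 2 + 3 - (Module.finrank ℝ E : ℝ) / 2 = 3 by rw [hd]; ring] at this
  -- the closed form
  rw [iteratedFDeriv_three_heatKernel_apply hs.ne' u w v y]
  set Q₁ : ℝ := ⟪y, u⟫ * ⟪w, v⟫ + ⟪u, w⟫ * ⟪y, v⟫ + ⟪y, w⟫ * ⟪u, v⟫ with hQ₁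
  set Q₂ : ℝ := ⟪y, u⟫ * ⟪y, w⟫ * ⟪y, v⟫ with hQ₂
  have hQ₁le : |Q₁| ≤ 3 * ‖y‖ := by
    have e1 : |⟪y, u⟫ * ⟪w, v⟫| ≤ ‖y‖ := by
      rw [abs_mul]
      calc |⟪y, u⟫| * |⟪w, v⟫| ≤ ‖y‖ * 1 :=
            mul_le_mul (abs_inner_le_norm_of_norm_le_one hu y)
              (abs_inner_le_one_of_norm_le_one hw hv) (abs_nonneg _) (norm_nonneg _)
        _ = ‖y‖ := mul_one _
    have e2 : |⟪u, w⟫ * ⟪y, v⟫| ≤ ‖y‖ := by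
      rw [abs_mul]
      calc |⟪u, w⟫| * |⟪y, v⟫| ≤ 1 * ‖y‖ :=
            mul_le_mul (abs_inner_le_one_of_norm_le_one hu hw)
              (abs_inner_le_norm_of_norm_le_one hv y) (abs_nonneg _) zero_le_one
        _ = ‖y‖ := one_mul _
    have e3 : |⟪y, w⟫ * ⟪u, v⟫| ≤ ‖y‖ := by
      rw [abs_mul]
      calc |⟪y, w⟫| * |⟪u, v⟫| ≤ ‖y‖ * 1 :=
            mul_le_mul (abs_inner_le_norm_of_norm_le_one hw y)
              (abs_inner_le_one_of_norm_le_one hu hv) (abs_nonneg _) (norm_nonneg _)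
        _ = ‖y‖ := mul_one _
    calc |Q₁| ≤ |⟪y, u⟫ * ⟪w, v⟫| + |⟪u, w⟫ * ⟪y, v⟫| + |⟪y, w⟫ * ⟪u, v⟫| := abs_add_three _ _ _
      _ ≤ ‖y‖ + ‖y‖ + ‖y‖ := add_le_add (add_le_add e1 e2) e3
      _ = 3 * ‖y‖ := by ring
  have hQ₂le : |Q₂| ≤ ‖y‖ ^ 3 := by
    rw [hQ₂, abs_mul, abs_mul]
    calc |⟪y, u⟫| * |⟪y, w⟫| * |⟪y, v⟫| ≤ ‖y‖ * ‖y‖ * ‖y‖ :=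
          mul_le_mul (mul_le_mul (abs_inner_le_norm_of_norm_le_one hu y)
            (abs_inner_le_norm_of_norm_le_one hw y) (abs_nonneg _) (norm_nonneg _))
            (abs_inner_le_norm_of_norm_le_one hv y) (abs_nonneg _) (by positivity)
      _ = ‖y‖ ^ 3 := by ring
  -- powers of `ρ`
  have hpow1 : ρ ^ (-(d / 2 + 2)) * ρ ^ (1 / 2 : ℝ) = ρ ^ (-((d + 3) / 2)) := by
    rw [← Real.rpow_add hρ0]; ring_nf
  have hpow3 : ρ ^ (-(d / 2 + 3)) * (ρ ^ (1 / 2 : ℝ)) ^ 3 = ρ ^ (-((d + 3) / 2)) := by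
    rw [← Real.rpow_natCast, ← Real.rpow_mul hρ0.le, ← Real.rpow_add hρ0]; ring_nf
  have hs2 : (0 : ℝ) < 4 * s ^ 2 := by positivity
  have hs3 : (0 : ℝ) < 8 * s ^ 3 := by positivity
  -- term 1
  have T1 : heatKernel s y * (|Q₁| / (4 * s ^ 2)) ≤ 3 / 4 * C₁ * ρ ^ (-((d + 3) / 2)) := by
    calc heatKernel s y * (|Q₁| / (4 * s ^ 2))
        ≤ (C₁ * s ^ (2 : ℝ) * ρ ^ (-(d / 2 + 2))) * (3 * ‖y‖ / (4 * s ^ 2)) := by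
          gcongr
      _ = 3 / 4 * C₁ * (ρ ^ (-(d / 2 + 2)) * ‖y‖) := by
          rw [show s ^ (2 : ℝ) = s ^ 2 by rw [← Real.rpow_natCast]; norm_num]
          field_simp
      _ ≤ 3 / 4 * C₁ * (ρ ^ (-(d / 2 + 2)) * ρ ^ (1 / 2 : ℝ)) := by gcongr
      _ = 3 / 4 * C₁ * ρ ^ (-((d + 3) / 2)) := by rw [hpow1]
  -- term 2
  have T2 : heatKernel s y * (|Q₂| / (8 * s ^ 3)) ≤ C₂ / 8 * ρ ^ (-((d + 3) / 2)) := by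
    calc heatKernel s y * (|Q₂| / (8 * s ^ 3))
        ≤ (C₂ * s ^ (3 : ℝ) * ρ ^ (-(d / 2 + 3))) * (‖y‖ ^ 3 / (8 * s ^ 3)) := by
          gcongr
      _ = C₂ / 8 * (ρ ^ (-(d / 2 + 3)) * ‖y‖ ^ 3) := by
          rw [show s ^ (3 : ℝ) = s ^ 3 by rw [← Real.rpow_natCast]; norm_num]
          field_simp
      _ ≤ C₂ / 8 * (ρ ^ (-(d / 2 + 3)) * (ρ ^ (1 / 2 : ℝ)) ^ 3) := by gcongr
      _ = C₂ / 8 * ρ ^ (-((d + 3) / 2)) := by rw [hpow3]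
  calc |heatKernel s y * (Q₁ / (4 * s ^ 2) - Q₂ / (8 * s ^ 3))|
      = heatKernel s y * |Q₁ / (4 * s ^ 2) - Q₂ / (8 * s ^ 3)| := by
        rw [abs_mul, abs_of_nonneg hG0]
    _ ≤ heatKernel s y * (|Q₁| / (4 * s ^ 2) + |Q₂| / (8 * s ^ 3)) := by
        refine mul_le_mul_of_nonneg_left ?_ hG0
        calc |Q₁ / (4 * s ^ 2) - Q₂ / (8 * s ^ 3)| ≤ |Q₁ / (4 * s ^ 2)| + |Q₂ / (8 * s ^ 3)| :=
              abs_sub _ _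
          _ = |Q₁| / (4 * s ^ 2) + |Q₂| / (8 * s ^ 3) := by
              rw [abs_div, abs_div, abs_of_pos hs2, abs_of_pos hs3]
    _ = heatKernel s y * (|Q₁| / (4 * s ^ 2)) + heatKernel s y * (|Q₂| / (8 * s ^ 3)) := by ring
    _ ≤ 3 / 4 * C₁ * ρ ^ (-((d + 3) / 2)) + C₂ / 8 * ρ ^ (-((d + 3) / 2)) := add_le_add T1 T2
    _ = (3 / 4 * C₁ + C₂ / 8) * ρ ^ (-((d + 3) / 2)) := by ring

end General

/-! ### Dimension three: the time integral of `|D³G_s|` and the Oseen bound for `e^{aΔ}Γ₀` -/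

section DimThree

/-- **`∫_a^∞ |D³G_s(y)[u,v,w]| ds ≤ C (a + ‖y‖²)^{-2}`** in `ℝ³`, for `a > 0` and
`‖u‖, ‖v‖, ‖w‖ ≤ 1` (integrate `(s + ‖y‖²)^{-3}` in `s`). This is the parabolic bound
`O(δ₂^{-4})` for the kernel of `e^{aΔ}∇∂ⱼ∂ₗΔ⁻¹` (Lemarié-Rieusset 2016, p. 475; Koch–Tataru 2001,
(14)). [cite: KochTataruAdvMath2001, §3 (14)] -/
theorem exists_lintegral_Ioi_enorm_iteratedFDeriv_three_heatKernel_le :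
    ∃ C : ℝ, 0 < C ∧ ∀ {a : ℝ}, 0 < a → ∀ (y u v w : (EuclideanSpace ℝ (Fin 3))), ‖u‖ ≤ 1 → ‖v‖ ≤ 1 → ‖w‖ ≤ 1 →
      ∫⁻ s in Ioi a, ‖iteratedFDeriv ℝ 3 (heatKernel s) y ![u, v, w]‖ₑ ≤
        ENNReal.ofReal (C * (a + ‖y‖ ^ 2) ^ (-(2 : ℝ))) := by
  obtain ⟨C, hC, h⟩ := exists_abs_iteratedFDeriv_three_heatKernel_le (E := (EuclideanSpace ℝ (Fin 3)))
  refine ⟨C / 2, by positivity, fun {a} ha y u v w hu hv hw => ?_⟩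
  set ρ : ℝ := ‖y‖ ^ 2 with hρ
  have haρ : 0 < a + ρ := by positivity
  have hexp : -(((Module.finrank ℝ (EuclideanSpace ℝ (Fin 3)) : ℝ) + 3) / 2) = (-3 : ℝ) := by
    rw [finrank_euclideanSpace_three]; norm_num
  -- pointwise bound on `(a, ∞)`
  have hpt : ∀ s ∈ Ioi a, ‖iteratedFDeriv ℝ 3 (heatKernel s) y ![u, v, w]‖ₑ ≤
      ENNReal.ofReal (C * (s + ρ) ^ (-3 : ℝ)) := by
    intro s hs
    have hs0 : 0 < s := ha.trans hs
    have := h hs0 y u v w hu hv hw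
    rw [hexp] at this
    rw [← ofReal_norm, Real.norm_eq_abs]
    exact ENNReal.ofReal_le_ofReal this
  obtain ⟨hint, hval⟩ := integral_Ioi_add_rpow (a := -3) (τ := a) (ρ := ρ) (by norm_num) haρ
  calc ∫⁻ s in Ioi a, ‖iteratedFDeriv ℝ 3 (heatKernel s) y ![u, v, w]‖ₑ
      ≤ ∫⁻ s in Ioi a, ENNReal.ofReal (C * (s + ρ) ^ (-3 : ℝ)) := setLIntegral_mono' measurableSet_Ioi hpt
    _ = ENNReal.ofReal (∫ s in Ioi a, C * (s + ρ) ^ (-3 : ℝ)) := by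
        rw [← ofReal_integral_eq_lintegral_ofReal (hint.const_mul C)]
        refine (ae_restrict_iff' measurableSet_Ioi).2 (Eventually.of_forall fun s hs => ?_)
        have : 0 < s + ρ := haρ.trans_le (by linarith [le_of_lt (show a < s from hs)])
        positivity
    _ = ENNReal.ofReal (C / 2 * (a + ‖y‖ ^ 2) ^ (-(2 : ℝ))) := by
        rw [integral_const_mul, hval]
        congr 1
        norm_num
        ring

variable {r₀ r₁ : ℝ}

/-- `|D³f(x)[u,v,w]|` in nested form is bounded by the norm of the iterated derivative, for
`‖u‖, ‖v‖, ‖w‖ ≤ 1` and `f ∈ C³`. [folklore] -/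
theorem abs_fderiv3_apply_le_norm_iteratedFDeriv {E : Type*} [NormedAddCommGroup E]
    [InnerProductSpace ℝ E] {f : E → ℝ} (hf : ContDiff ℝ 3 f) (x : E) {u v w : E} (hu : ‖u‖ ≤ 1)
    (hv : ‖v‖ ≤ 1) (hw : ‖w‖ ≤ 1) :
    |fderiv ℝ (fun z => fderiv ℝ (fun z' => fderiv ℝ f z' w) z v) x u| ≤
      ‖iteratedFDeriv ℝ 3 f x‖ := by
  rw [← iteratedFDeriv_three_apply hf x u v w, ← Real.norm_eq_abs]
  calc ‖iteratedFDeriv ℝ 3 f x ![u, v, w]‖ ≤ ‖iteratedFDeriv ℝ 3 f x‖ * ∏ i, ‖(![u, v, w]) i‖ :=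
        (iteratedFDeriv ℝ 3 f x).le_opNorm _
    _ ≤ ‖iteratedFDeriv ℝ 3 f x‖ * 1 := by
        refine mul_le_mul_of_nonneg_left ?_ (norm_nonneg _)
        rw [Fin.prod_univ_three]
        simp only [Matrix.cons_val_zero, Matrix.cons_val_one, Matrix.cons_val]
        calc ‖u‖ * ‖v‖ * ‖w‖ ≤ 1 * 1 * 1 := by gcongr
          _ = 1 := by norm_num
    _ = ‖iteratedFDeriv ℝ 3 f x‖ := mul_one _

/-- **Uniform bound for the `λ` part of the Duhamel representation**, pointwise in `x`: for
`0 < r₀ < r₁` there is `C` with `∫_a^∞ |heatD3 s u v w λ (x)| ds ≤ C` for all `a > 0`, `x`, and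
`‖u‖, ‖v‖, ‖w‖ ≤ 1`, `λ = newtonFarLaplacian r₀ r₁` (`|heatD3 s λ| ≤ sup ‖D³λ‖` for `s ≤ 1`,
derivatives on the smooth data; `|heatD3 s λ (x)| ≤ 27 s⁻¹ (s/3)⁻² ‖λ‖₁` for `s ≥ 1`).
[folklore] -/
theorem exists_lintegral_Ioi_enorm_heatD3_newtonFarLaplacian_pointwise_le (h₀ : 0 < r₀)
    (h₁ : r₀ < r₁) :
    ∃ C : ℝ, 0 ≤ C ∧ ∀ {a : ℝ}, 0 < a → ∀ (x u v w : (EuclideanSpace ℝ (Fin 3))), ‖u‖ ≤ 1 → ‖v‖ ≤ 1 → ‖w‖ ≤ 1 →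
      ∫⁻ s in Ioi a, ‖heatD3 s u v w (newtonFarLaplacian r₀ r₁) x‖ₑ ≤ ENNReal.ofReal C := by
  set lam := newtonFarLaplacian r₀ r₁ with hlam
  have hlam1 := memLp_one_newtonFarLaplacian h₀ h₁
  have hlamC : ContDiff ℝ ((⊤ : ℕ∞) : WithTop ℕ∞) lam := contDiff_newtonFarLaplacian h₀ h₁
  have hlamc := hasCompactSupport_newtonFarLaplacian h₀.le h₁
  have hlam3 : ContDiff ℝ 3 lam := contDiff_infty.1 hlamC 3
  -- `A = sup ‖D³λ‖`
  obtain ⟨A, hA⟩ := (hlam3.continuous_iteratedFDeriv (m := 3) le_rfl).bounded_above_of_compact_support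
    (hlamc.iteratedFDeriv 3)
  have hA0 : 0 ≤ A := (norm_nonneg _).trans (hA 0)
  -- `B = ‖λ‖₁`
  set B : ℝ≥0∞ := eLpNorm lam 1 volume with hB
  have hBfin : B ≠ ∞ := hlam1.eLpNorm_ne_top
  refine ⟨A + 243 / 2 * B.toReal, by positivity, fun {a} ha x u v w hu hv hw => ?_⟩
  -- regime `s ≤ 1`: derivatives on the data and the maximum principle
  have hsmall : ∀ {s : ℝ}, 0 < s → ‖heatD3 s u v w lam x‖ₑ ≤ ENNReal.ofReal A := by
    intro s hs
    rw [heatD3_eq_heatExtension_fderiv3 hlamC hlamc hs u v w, ← ofReal_norm]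
    refine ENNReal.ofReal_le_ofReal (UnboundedOperators.norm_heatExtension_le (fun z => ?_) hs x)
    rw [Real.norm_eq_abs]
    exact (abs_fderiv3_apply_le_norm_iteratedFDeriv hlam3 z hu hv hw).trans (hA z)
  -- regime `s ≥ 1`: Young, `27 s⁻¹ (s/3)⁻² ‖λ‖₁ = 243 s⁻³ ‖λ‖₁`
  have hlarge : ∀ {s : ℝ}, 0 < s → ‖heatD3 s u v w lam x‖ₑ ≤
      ENNReal.ofReal (243 * s ^ (-(3 : ℝ))) * B := by
    intro s hs
    have h3 : 0 < s / 3 := by positivity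
    have h := enorm_heatD3_le_dim3 finrank_euclideanSpace_three hlam1 le_rfl hs hu hv x ∞ (w := w)
    have hK := eLpNorm_top_fderiv_heatKernel_apply_le_dim3 finrank_euclideanSpace_three h3 hw
    refine h.trans ?_
    rw [← mul_assoc]
    refine mul_le_mul_left ((mul_le_mul_right hK _).trans ?_) _
    rw [← ENNReal.ofReal_mul (by positivity)]
    refine ENNReal.ofReal_le_ofReal (le_of_eq ?_)
    rw [Real.div_rpow hs.le (by norm_num), Real.rpow_neg hs.le, Real.rpow_neg hs.le,
      show ((3 : ℝ) ^ (-2 : ℝ)) = 1 / 9 by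
        rw [Real.rpow_neg (by norm_num)]; norm_num,
      show s ^ (3 : ℝ) = s * s ^ (2 : ℝ) by
        rw [show (3 : ℝ) = 1 + 2 by norm_num, Real.rpow_add hs, Real.rpow_one]]
    field_simp
    ring
  -- pointwise bound by the sum of the two regimes, integrate
  have hpt : ∀ s ∈ Ioi a, ‖heatD3 s u v w lam x‖ₑ ≤
      (Ioc (0 : ℝ) 1).indicator (fun _ => ENNReal.ofReal A) s +
        (Ioi (1 : ℝ)).indicator (fun s => ENNReal.ofReal (243 * s ^ (-(3 : ℝ))) * B) s := by
    intro s hs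
    have hs0 : 0 < s := ha.trans hs
    by_cases h1 : s ≤ 1
    · rw [indicator_of_mem (show s ∈ Ioc (0 : ℝ) 1 from ⟨hs0, h1⟩),
        indicator_of_notMem (show s ∉ Ioi (1 : ℝ) from not_lt.2 h1), add_zero]
      exact hsmall hs0
    · push Not at h1
      rw [indicator_of_notMem (show s ∉ Ioc (0 : ℝ) 1 from fun h => (not_le.2 h1) h.2),
        indicator_of_mem (show s ∈ Ioi (1 : ℝ) from h1), zero_add]
      exact hlarge hs0
  calc ∫⁻ s in Ioi a, ‖heatD3 s u v w lam x‖ₑ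
      ≤ ∫⁻ s in Ioi a, ((Ioc (0 : ℝ) 1).indicator (fun _ => ENNReal.ofReal A) s +
          (Ioi (1 : ℝ)).indicator (fun s => ENNReal.ofReal (243 * s ^ (-(3 : ℝ))) * B) s) :=
        setLIntegral_mono' measurableSet_Ioi hpt
    _ ≤ ∫⁻ s, ((Ioc (0 : ℝ) 1).indicator (fun _ => ENNReal.ofReal A) s +
          (Ioi (1 : ℝ)).indicator (fun s => ENNReal.ofReal (243 * s ^ (-(3 : ℝ))) * B) s) :=
        setLIntegral_le_lintegral _ _
    _ = (∫⁻ s, (Ioc (0 : ℝ) 1).indicator (fun _ => ENNReal.ofReal A) s) +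
          ∫⁻ s, (Ioi (1 : ℝ)).indicator (fun s => ENNReal.ofReal (243 * s ^ (-(3 : ℝ))) * B) s :=
        lintegral_add_left (measurable_const.indicator measurableSet_Ioc) _
    _ ≤ ENNReal.ofReal A + ENNReal.ofReal (243 / 2) * B := by
        refine add_le_add ?_ ?_
        · rw [lintegral_indicator measurableSet_Ioc, setLIntegral_const, Real.volume_Ioc]
          simp
        · rw [lintegral_indicator measurableSet_Ioi, lintegral_mul_const _ (by fun_prop)]
          refine mul_le_mul_left (le_of_eq ?_) _
          have h2 : ∀ s : ℝ, ENNReal.ofReal (243 * s ^ (-(3 : ℝ))) =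
              ENNReal.ofReal 243 * ENNReal.ofReal (s ^ (-(3 : ℝ))) := fun s =>
            ENNReal.ofReal_mul (by norm_num)
          simp_rw [h2]
          rw [lintegral_const_mul _ (by fun_prop),
            UnboundedOperators.lintegral_Ioi_rpow (by norm_num : (-(3 : ℝ)) < -1) one_pos,
            Real.one_rpow, ← ENNReal.ofReal_mul (by norm_num)]
          congr 1; norm_num
    _ = ENNReal.ofReal (A + 243 / 2 * B.toReal) := by
        rw [ENNReal.ofReal_add hA0 (by positivity), ENNReal.ofReal_mul (by norm_num : (0:ℝ) ≤ 243 / 2),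
          ENNReal.ofReal_toReal hBfin]

/-- **The pointwise Oseen bound for the heat flow of the truncated Newtonian kernel** (the kernel
of `e^{νtΔ}∇∂ⱼ∂ₗΔ⁻¹` is `O(δ₂^{-4})`, Lemarié-Rieusset 2016, p. 475 and §6.2; Koch–Tataru 2001,
(14)), for the truncated kernel `Γ₀ = newtonNear r₀ r₁` of the tree: for `0 < r₀ < r₁` there is
`C` with `|∂ᵤ∂ᵥ∂_w e^{aΔ}Γ₀ (x)| ≤ C ((a + ‖x‖²)^{-2} + 1)` for all `a > 0`, `x ∈ ℝ³` and
`‖u‖, ‖v‖, ‖w‖ ≤ 1` (the Duhamel representation `heatD3 a Γ₀ = -∫_a^∞ (D³G_s - heatD3 s λ) ds`,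
the bound `∫_a^∞ |D³G_s(x)| ds ≤ C(a + ‖x‖²)^{-2}`, and the bounded `λ` part). [cite: LemarieRieusset2016, §13.9 Step 3 p. 475] -/
theorem exists_abs_heatD3_newtonNear_le (h₀ : 0 < r₀) (h₁ : r₀ < r₁) :
    ∃ C : ℝ, 0 < C ∧ ∀ {a : ℝ}, 0 < a → ∀ (x u v w : (EuclideanSpace ℝ (Fin 3))), ‖u‖ ≤ 1 → ‖v‖ ≤ 1 → ‖w‖ ≤ 1 →
      |heatD3 a u v w (newtonNear r₀ r₁) x| ≤ C * ((a + ‖x‖ ^ 2) ^ (-(2 : ℝ)) + 1) := by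
  obtain ⟨C₁, hC₁, hG⟩ := exists_lintegral_Ioi_enorm_iteratedFDeriv_three_heatKernel_le
  obtain ⟨C₂, hC₂, hL⟩ := exists_lintegral_Ioi_enorm_heatD3_newtonFarLaplacian_pointwise_le h₀ h₁
  refine ⟨C₁ + C₂ + 1, by positivity, fun {a} ha x u v w hu hv hw => ?_⟩
  have hρ : 0 ≤ (a + ‖x‖ ^ 2) ^ (-(2 : ℝ)) := Real.rpow_nonneg (by positivity) _
  have key : ‖heatD3 a u v w (newtonNear r₀ r₁) x‖ₑ ≤
      ENNReal.ofReal (C₁ * (a + ‖x‖ ^ 2) ^ (-(2 : ℝ))) + ENNReal.ofReal C₂ := by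
    rw [heatD3_newtonNear_eq_neg_integral_Ioi h₀ h₁ ha, enorm_neg]
    calc ‖∫ s in Ioi a, (iteratedFDeriv ℝ 3 (heatKernel s) x ![u, v, w] -
          heatD3 s u v w (newtonFarLaplacian r₀ r₁) x)‖ₑ
        ≤ ∫⁻ s in Ioi a, ‖iteratedFDeriv ℝ 3 (heatKernel s) x ![u, v, w] -
            heatD3 s u v w (newtonFarLaplacian r₀ r₁) x‖ₑ := enorm_integral_le_lintegral_enorm _
      _ ≤ ∫⁻ s in Ioi a, (‖iteratedFDeriv ℝ 3 (heatKernel s) x ![u, v, w]‖ₑ +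
            ‖heatD3 s u v w (newtonFarLaplacian r₀ r₁) x‖ₑ) := lintegral_mono fun s => enorm_sub_le
      _ = (∫⁻ s in Ioi a, ‖iteratedFDeriv ℝ 3 (heatKernel s) x ![u, v, w]‖ₑ) +
            ∫⁻ s in Ioi a, ‖heatD3 s u v w (newtonFarLaplacian r₀ r₁) x‖ₑ := by
          refine lintegral_add_left' ?_ _
          have hc : ContinuousOn (fun s : ℝ => iteratedFDeriv ℝ 3 (heatKernel s) x ![u, v, w]) (Ioi a) := by
            have h := FunctionSpaces.continuousOn_iteratedFDeriv_heatKernel_uncurry (E := (EuclideanSpace ℝ (Fin 3))) 3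
            have h' := (ContinuousMultilinearMap.apply ℝ (fun _ : Fin 3 => (EuclideanSpace ℝ (Fin 3))) ℝ ![u, v, w]).continuous.comp_continuousOn
              (h.comp (f := fun s : ℝ => ((s, x) : ℝ × (EuclideanSpace ℝ (Fin 3)))) (by fun_prop) fun s hs => ⟨ha.trans hs, mem_univ _⟩)
            exact h'
          exact (hc.aestronglyMeasurable measurableSet_Ioi).aemeasurable.enorm
      _ ≤ _ := add_le_add (hG ha x u v w hu hv hw) (hL ha x u v w hu hv hw)
  rw [← ENNReal.ofReal_add (by positivity) hC₂, ← ofReal_norm, Real.norm_eq_abs] at key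
  have := (ENNReal.ofReal_le_ofReal_iff (by positivity)).1 key
  nlinarith

/-! ### The heat kernel and its gradient against `(a + ‖y‖²)` in `ℝ³` -/

/-- **`G_a(y) ≤ C (a + ‖y‖²)^{-3/2}`** in `ℝ³` (`a > 0`): the parabolic form `|W_{νt}(x)| ≤ C δ₂^{-3}`
of the heat kernel bound (Lemarié-Rieusset 2016, p. 475; `exists_heatKernel_le_rpow` with
`e = 3/2`). [folklore] -/
theorem exists_heatKernel_le_add_sq_rpow_dim3 :
    ∃ C : ℝ, 0 < C ∧ ∀ {a : ℝ}, 0 < a → ∀ y : (EuclideanSpace ℝ (Fin 3)),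
      heatKernel a y ≤ C * (a + ‖y‖ ^ 2) ^ (-(3 / 2 : ℝ)) := by
  obtain ⟨C, hC, h⟩ := exists_heatKernel_le_rpow (E := (EuclideanSpace ℝ (Fin 3))) (3 / 2)
  refine ⟨C, hC, fun {a} ha y => ?_⟩
  have := h ha y
  rwa [finrank_euclideanSpace_three, show (3 / 2 : ℝ) - ((3 : ℕ) : ℝ) / 2 = 0 by norm_num,
    Real.rpow_zero, mul_one] at this

/-- **`|∂ᵥG_a(y)| ≤ C ‖v‖ (a + ‖y‖²)^{-2}`** in `ℝ³` (`a > 0`): the parabolic form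
`|∇W_{νt}(x)| ≤ C δ₂^{-4}` of the gradient bound (Lemarié-Rieusset 2016, p. 475;
`exists_abs_heatKernelGrad_le` in dimension three). [folklore] -/
theorem exists_abs_heatKernelGrad_le_dim3 :
    ∃ C : ℝ, 0 < C ∧ ∀ {a : ℝ}, 0 < a → ∀ v y : (EuclideanSpace ℝ (Fin 3)),
      |heatKernelGrad v a y| ≤ C * ‖v‖ * (a + ‖y‖ ^ 2) ^ (-(2 : ℝ)) := by
  obtain ⟨C, hC, h⟩ := exists_abs_heatKernelGrad_le (E := (EuclideanSpace ℝ (Fin 3)))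
  refine ⟨C, hC, fun {a} ha v y => ?_⟩
  have := h ha v y
  rwa [finrank_euclideanSpace_three,
    show -((((3 : ℕ) : ℝ) + 1) / 2) = (-(2 : ℝ)) by norm_num] at this

/-! ### Comparison with the parabolic distance `δ₂` -/

/-- `δ₂((t,x),(s,y))² ≤ 2 (|t - s| + ‖x - y‖²)` (`(√a + b)² ≤ 2(a + b²)`). [folklore] -/
theorem parabolicDist_sq_le (t s : ℝ) (x y : (EuclideanSpace ℝ (Fin 3))) :
    parabolicDist (t, x) (s, y) ^ 2 ≤ 2 * (|t - s| + ‖x - y‖ ^ 2) := by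
  rw [parabolicDist]
  have h1 : Real.sqrt |t - s| ^ 2 = |t - s| := Real.sq_sqrt (abs_nonneg _)
  nlinarith [sq_nonneg (Real.sqrt |t - s| - ‖x - y‖), Real.sqrt_nonneg |t - s|, norm_nonneg (x - y)]

/-- **`(ν(t-s) + ‖x-y‖²)^{-e} ≤ (min(ν,1)/2)^{-e} δ₂((t,x),(s,y))^{-2e}`** for `s < t`, `ν > 0`,
`e ≥ 0`: the heat-kernel weights are dominated by the Riesz kernels of the parabolic distance.
[folklore] -/
theorem add_sq_rpow_neg_le_parabolicDist_rpow {ν : ℝ} (hν : 0 < ν) {t s : ℝ} (hts : s < t)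
    (x y : (EuclideanSpace ℝ (Fin 3))) {e : ℝ} (he : 0 ≤ e) :
    (ν * (t - s) + ‖x - y‖ ^ 2) ^ (-e) ≤
      (min ν 1 / 2) ^ (-e) * parabolicDist (t, x) (s, y) ^ (-(2 * e)) := by
  set δ : ℝ := parabolicDist (t, x) (s, y) with hδ
  set m : ℝ := min ν 1 with hm
  have hm0 : 0 < m := lt_min hν one_pos
  have hδ0 : 0 < δ := by
    rcases (parabolicDist_nonneg (t, x) (s, y)).eq_or_lt with h | h
    · exact absurd (parabolicDist_eq_zero.1 h.symm) (by
        intro heq; exact hts.ne' (congrArg Prod.fst heq))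
    · exact h
  have hts' : |t - s| = t - s := abs_of_pos (sub_pos.2 hts)
  -- `m δ²/2 ≤ ν(t-s) + ‖x-y‖²`
  have hbase : m / 2 * δ ^ 2 ≤ ν * (t - s) + ‖x - y‖ ^ 2 := by
    have h1 := parabolicDist_sq_le t s x y
    rw [hts'] at h1
    have h2 : m * ((t - s) + ‖x - y‖ ^ 2) ≤ ν * (t - s) + ‖x - y‖ ^ 2 := by
      have hm1 : m ≤ ν := min_le_left _ _
      have hm2 : m ≤ 1 := min_le_right _ _
      have hts0 : 0 ≤ t - s := (sub_pos.2 hts).le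
      nlinarith [norm_nonneg (x - y), sq_nonneg ‖x - y‖]
    nlinarith
  have hpos : 0 < m / 2 * δ ^ 2 := by positivity
  calc (ν * (t - s) + ‖x - y‖ ^ 2) ^ (-e)
      ≤ (m / 2 * δ ^ 2) ^ (-e) := Real.rpow_le_rpow_of_nonpos hpos hbase (neg_nonpos.2 he)
    _ = (m / 2) ^ (-e) * δ ^ (-(2 * e)) := by
        rw [Real.mul_rpow (by positivity) (by positivity), show δ ^ 2 = δ ^ (2 : ℝ) by
          rw [← Real.rpow_natCast]; norm_num, ← Real.rpow_mul hδ0.le]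
        ring_nf

/-- **`ℝ≥0∞` form against the Riesz kernels**: for `s < t`, `ν > 0` and `e > 0`,
`ofReal ((ν(t-s) + ‖x-y‖²)^{-e}) ≤ ofReal ((min(ν,1)/2)^{-e}) · (ofReal δ₂((t,x),(s,y)) ^ (2e))⁻¹`,
the right-hand factor being the kernel of `parabolicRieszPotential (5 - 2e)`. [folklore] -/
theorem ofReal_add_sq_rpow_neg_le_parabolicKernel {ν : ℝ} (hν : 0 < ν) {t s : ℝ} (hts : s < t)
    (x y : (EuclideanSpace ℝ (Fin 3))) {e : ℝ} (he : 0 < e) :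
    ENNReal.ofReal ((ν * (t - s) + ‖x - y‖ ^ 2) ^ (-e)) ≤
      ENNReal.ofReal ((min ν 1 / 2) ^ (-e)) *
        (ENNReal.ofReal (parabolicDist (t, x) (s, y)) ^ (2 * e))⁻¹ := by
  set δ : ℝ := parabolicDist (t, x) (s, y) with hδ
  have hδ0 : 0 < δ := by
    rcases (parabolicDist_nonneg (t, x) (s, y)).eq_or_lt with h | h
    · exact absurd (parabolicDist_eq_zero.1 h.symm) (by
        intro heq; exact hts.ne' (congrArg Prod.fst heq))
    · exact h
  have h := add_sq_rpow_neg_le_parabolicDist_rpow hν hts x y he.le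
  have hc : 0 ≤ (min ν 1 / 2) ^ (-e) := Real.rpow_nonneg (by positivity) _
  calc ENNReal.ofReal ((ν * (t - s) + ‖x - y‖ ^ 2) ^ (-e))
      ≤ ENNReal.ofReal ((min ν 1 / 2) ^ (-e) * δ ^ (-(2 * e))) := ENNReal.ofReal_le_ofReal h
    _ = ENNReal.ofReal ((min ν 1 / 2) ^ (-e)) * ENNReal.ofReal (δ ^ (-(2 * e))) :=
        ENNReal.ofReal_mul hc
    _ = ENNReal.ofReal ((min ν 1 / 2) ^ (-e)) * (ENNReal.ofReal δ ^ (2 * e))⁻¹ := by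
        congr 1
        rw [Real.rpow_neg hδ0.le, ENNReal.ofReal_inv_of_pos (Real.rpow_pos_of_pos hδ0 _),
          ENNReal.ofReal_rpow_of_pos hδ0]

/-- The case `e = 3/2`: the heat-kernel weight `(ν(t-s) + ‖x-y‖²)^{-3/2}` against the kernel
`(ofReal δ₂ ^ (5 - 2))⁻¹` of `𝓘₂`. [folklore] -/
theorem ofReal_add_sq_rpow_neg_three_halves_le {ν : ℝ} (hν : 0 < ν) {t s : ℝ} (hts : s < t)
    (x y : (EuclideanSpace ℝ (Fin 3))) :
    ENNReal.ofReal ((ν * (t - s) + ‖x - y‖ ^ 2) ^ (-(3 / 2 : ℝ))) ≤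
      ENNReal.ofReal ((min ν 1 / 2) ^ (-(3 / 2 : ℝ))) *
        (ENNReal.ofReal (parabolicDist (t, x) (s, y)) ^ ((5 : ℝ) - 2))⁻¹ := by
  have h := ofReal_add_sq_rpow_neg_le_parabolicKernel hν hts x y (by norm_num : (0 : ℝ) < 3 / 2)
  rwa [show 2 * (3 / 2 : ℝ) = (5 : ℝ) - 2 by norm_num] at h

/-- The case `e = 2`: the gradient / Oseen weight `(ν(t-s) + ‖x-y‖²)^{-2}` against the kernel
`(ofReal δ₂ ^ (5 - 1))⁻¹` of `𝓘₁`. [folklore] -/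
theorem ofReal_add_sq_rpow_neg_two_le {ν : ℝ} (hν : 0 < ν) {t s : ℝ} (hts : s < t) (x y : (EuclideanSpace ℝ (Fin 3))) :
    ENNReal.ofReal ((ν * (t - s) + ‖x - y‖ ^ 2) ^ (-(2 : ℝ))) ≤
      ENNReal.ofReal ((min ν 1 / 2) ^ (-(2 : ℝ))) *
        (ENNReal.ofReal (parabolicDist (t, x) (s, y)) ^ ((5 : ℝ) - 1))⁻¹ := by
  have h := ofReal_add_sq_rpow_neg_le_parabolicKernel hν hts x y (by norm_num : (0 : ℝ) < 2)
  rwa [show 2 * (2 : ℝ) = (5 : ℝ) - 1 by norm_num] at h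

/-- On a parabolically bounded configuration the kernel of `𝓘₂` is dominated by that of `𝓘₁`:
if `δ₂(z, w) ≤ R` then `(ofReal δ₂ ^ (5-2))⁻¹ ≤ ofReal R · (ofReal δ₂ ^ (5-1))⁻¹`
(`δ₂^{-3} = δ₂ · δ₂^{-4}`). [folklore] -/
theorem parabolicKernel_two_le_mul_parabolicKernel_one {z w : ℝ × (EuclideanSpace ℝ (Fin 3))} {R : ℝ}
    (hR : parabolicDist z w ≤ R) (hzw : z ≠ w) :
    (ENNReal.ofReal (parabolicDist z w) ^ ((5 : ℝ) - 2))⁻¹ ≤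
      ENNReal.ofReal R * (ENNReal.ofReal (parabolicDist z w) ^ ((5 : ℝ) - 1))⁻¹ := by
  set δ : ℝ := parabolicDist z w with hδ
  have hδ0 : 0 < δ := by
    rcases (parabolicDist_nonneg z w).eq_or_lt with h | h
    · exact absurd (parabolicDist_eq_zero.1 h.symm) hzw
    · exact h
  have hδ' : ENNReal.ofReal δ ≠ 0 := (ENNReal.ofReal_pos.2 hδ0).ne'
  have hδt : ENNReal.ofReal δ ≠ ∞ := ENNReal.ofReal_ne_top
  -- `δ^{-3} = δ · δ^{-4} ≤ R δ^{-4}`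
  have key : (ENNReal.ofReal δ ^ ((5 : ℝ) - 2))⁻¹ = ENNReal.ofReal δ * (ENNReal.ofReal δ ^ ((5 : ℝ) - 1))⁻¹ := by
    rw [show (5 : ℝ) - 1 = 1 + ((5 : ℝ) - 2) by norm_num, ENNReal.rpow_add _ _ hδ' hδt,
      ENNReal.rpow_one, ENNReal.mul_inv (Or.inl hδ') (Or.inl hδt), ← mul_assoc,
      ENNReal.mul_inv_cancel hδ' hδt, one_mul]
  rw [key]
  exact mul_le_mul_left (ENNReal.ofReal_le_ofReal hR) _

end DimThree

end Literature.Analysis.FluidPDE
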